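import Mathlib
import Summits.NavierStokesRegularity.FluidComputer.CarrierBudget

/-!
# The carrier life cycle: a band's sup carrier relative to its own peak — windows, switch-on instants, and the record on four designs

Cell `pub-fluidc` (FLUID COMPUTER; host summit `NavierStokesRegularity`, negation side, machine paradigm), prover seat p1 (gen 17,
2026-08-26). HONEST FRAMING: low prior, high value-of-information experiment on Tao's machine paradigm; NOT a claim that NS blows up.
Nothing in this file is about the Navier–Stokes equations: §1 is elementary real analysis (a logarithmic rate bounded below / above on a
window bounds the growth factor of a positive quantity across it), §2 is the bookkeeping of p1's reader `lifecycle.py` 0.1.0 (deposit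
`atlas/rung-next/p1/spatial/transfer/lifecycle/`; HOME/STATUS p1 gen 17 information line) — the CAP-AVERAGED class log-rates of each band
sup carrier in windows placed relative to the carrier's OWN velocity peak `t_U`, and the instants at which its BACK class (pairs with a
factor in the smaller scales) switches on — typed as records, and §3 is arithmetic on those numbers in the currency of the LEAD's handle
(h2) ('the winner's own growth ×1.81 → ≥ ×2.11'; HOME/PLAN §8aa). Companion of `CarrierBudget` (§3 there = the term-by-term windows of
record that §2 here re-windows) and `TriadClassLedger` (the class algebra). Words: none — 'leak' names `back < 0`, 'strain-kept' names a
window with `strain ≥ 2 ∧ |back| ≤ 0.2`, 'sequenced' names 'a strain-kept window followed on the SAME carrier by a window with back ≤ −1.8'.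
128³ rows (the deposit's amplitude caveat: r₂ / P₂ at −4 % / −9 % on design A versus the certified columns). 0 sorry; no named fact.
-/

noncomputable section

open Set

namespace Summit.NavierStokesRegularity.FluidComputer.CarrierLifeCycle

open Summit.NavierStokesRegularity.FluidComputer.CarrierBudget (Terms)

/-! ## §1 A log-rate floor (ceiling) on a window bounds the growth factor across it -/

/-- **GROWTH FROM A RATE FLOOR.** If a positive quantity `W` is continuous on `[a, b]`, differentiable inside, and its logarithmic rate in the
reader's convention satisfies `d ln W²/dt ≥ c` there (written without logarithms: `c·W ≤ 2·W'`), then `W b ≥ W a · exp (c (b − a)/2)`. This is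
what a 'strain-kept window' buys: the window's mean total rate and its LENGTH enter only through their product. -/
theorem growth_of_lograte_ge {W : ℝ → ℝ} {a b c : ℝ} (hab : a ≤ b) (hpos : ∀ x ∈ Icc a b, 0 < W x) (hc : ContinuousOn W (Icc a b))
    (hd : DifferentiableOn ℝ W (Ioo a b)) (hrate : ∀ x ∈ Ioo a b, c * W x ≤ 2 * deriv W x) :
    W a * Real.exp (c * (b - a) / 2) ≤ W b := by
  have hne : ∀ x ∈ Icc a b, W x ≠ 0 := fun x hx => (hpos x hx).ne'
  have hlc : ContinuousOn (fun t => Real.log (W t)) (Icc a b) := hc.log hne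
  have hld : DifferentiableOn ℝ (fun t => Real.log (W t)) (interior (Icc a b)) := by
    rw [interior_Icc]; exact hd.log fun x hx => hne x (Ioo_subset_Icc_self hx)
  have hge : ∀ x ∈ interior (Icc a b), c / 2 ≤ deriv (fun t => Real.log (W t)) x := by
    intro x hx
    rw [interior_Icc] at hx
    have hWx : 0 < W x := hpos x (Ioo_subset_Icc_self hx)
    have hdx : DifferentiableAt ℝ W x := (hd x hx).differentiableAt (Ioo_mem_nhds hx.1 hx.2)
    rw [deriv.log hdx hWx.ne', le_div_iff₀ hWx]
    have := hrate x hx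
    linarith
  have key := (convex_Icc a b).mul_sub_le_image_sub_of_le_deriv hlc hld hge a (left_mem_Icc.2 hab) b (right_mem_Icc.2 hab) hab
  have hWa : 0 < W a := hpos a (left_mem_Icc.2 hab)
  have hWb : 0 < W b := hpos b (right_mem_Icc.2 hab)
  calc W a * Real.exp (c * (b - a) / 2) = Real.exp (Real.log (W a) + c / 2 * (b - a)) := by
        rw [Real.exp_add, Real.exp_log hWa]; ring_nf
    _ ≤ Real.exp (Real.log (W b)) := Real.exp_le_exp.2 (by linarith)
    _ = W b := Real.exp_log hWb

/-- **DECAY FROM A RATE CEILING.** Symmetrically, `d ln W²/dt ≤ C` on the window gives `W b ≤ W a · exp (C (b − a)/2)` — what a 'leak window'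
costs once BACK has switched on. -/
theorem growth_of_lograte_le {W : ℝ → ℝ} {a b C : ℝ} (hab : a ≤ b) (hpos : ∀ x ∈ Icc a b, 0 < W x) (hc : ContinuousOn W (Icc a b))
    (hd : DifferentiableOn ℝ W (Ioo a b)) (hrate : ∀ x ∈ Ioo a b, 2 * deriv W x ≤ C * W x) :
    W b ≤ W a * Real.exp (C * (b - a) / 2) := by
  have hne : ∀ x ∈ Icc a b, W x ≠ 0 := fun x hx => (hpos x hx).ne'
  have hlc : ContinuousOn (fun t => Real.log (W t)) (Icc a b) := hc.log hne
  have hld : DifferentiableOn ℝ (fun t => Real.log (W t)) (interior (Icc a b)) := by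
    rw [interior_Icc]; exact hd.log fun x hx => hne x (Ioo_subset_Icc_self hx)
  have hle : ∀ x ∈ interior (Icc a b), deriv (fun t => Real.log (W t)) x ≤ C / 2 := by
    intro x hx
    rw [interior_Icc] at hx
    have hWx : 0 < W x := hpos x (Ioo_subset_Icc_self hx)
    have hdx : DifferentiableAt ℝ W x := (hd x hx).differentiableAt (Ioo_mem_nhds hx.1 hx.2)
    rw [deriv.log hdx hWx.ne', div_le_iff₀ hWx]
    have := hrate x hx
    linarith
  have key := (convex_Icc a b).image_sub_le_mul_sub_of_deriv_le hlc hld hle a (left_mem_Icc.2 hab) b (right_mem_Icc.2 hab) hab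
  have hWa : 0 < W a := hpos a (left_mem_Icc.2 hab)
  have hWb : 0 < W b := hpos b (right_mem_Icc.2 hab)
  calc W b = Real.exp (Real.log (W b)) := (Real.exp_log hWb).symm
    _ ≤ Real.exp (Real.log (W a) + C / 2 * (b - a)) := Real.exp_le_exp.2 (by linarith)
    _ = W a * Real.exp (C * (b - a) / 2) := by rw [Real.exp_add, Real.exp_log hWa]; ring_nf

/-- The growth factor a constant rate `ρ` sustains over a window of length `τ`: `exp (ρ τ / 2)`; it is monotone in the product `ρ τ` only. -/
def growthFactor (ρ τ : ℝ) : ℝ := Real.exp (ρ * τ / 2)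

/-- Trading rate for length: equal products `ρ τ` give equal growth factors. -/
theorem growthFactor_eq_of_prod_eq {ρ τ ρ' τ' : ℝ} (h : ρ * τ = ρ' * τ') : growthFactor ρ τ = growthFactor ρ' τ' := by
  unfold growthFactor; rw [h]

/-- A crude but sufficient lower bound: `1 + ρ τ / 2 ≤ growthFactor ρ τ`. -/
theorem one_add_le_growthFactor (ρ τ : ℝ) : 1 + ρ * τ / 2 ≤ growthFactor ρ τ := by
  unfold growthFactor; have := Real.add_one_le_exp (ρ * τ / 2); linarith

/-! ## §2 The record (cap-averaged d ln W²/dt class rates at the band ω-argmax; 128³; `lifecycle.py` on kit j255374–j255377)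

Designs `0` = u0_b⁽²⁾ (A), `1` = u0_b (B), `2` = u0_bE (C, Euler); the break point u0⁽²⁾ (D) separately. `Terms` = (strain, self, back) as in
`CarrierBudget` §3. -/

/-- A window of a carrier's life: its ends and the cap-averaged class rates (+ injection and total) over it. -/
structure Window where
  /-- window start -/
  a : ℝ
  /-- window end -/
  b : ℝ
  /-- strain / self / back window means -/
  terms : Terms
  /-- injection-class window mean -/
  inj : ℝ
  /-- total (all classes + viscous) window mean -/
  total : ℝ

/-- window length -/
def Window.len (w : Window) : ℝ := w.b - w.a

/-- LEVEL TWO, the WINNER's STRAIN-KEPT window `[2.05, t_on)` (A / B / C). -/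
def strainKept : Fin 3 → Window :=
  ![⟨2.05, 2.40, ⟨2.04, 0.11, -0.15⟩, 1.27, 3.00⟩, ⟨2.05, 2.45, ⟨2.02, 0.24, -0.20⟩, 1.09, 2.88⟩, ⟨2.05, 2.40, ⟨2.42, 0.42, -0.18⟩, 1.16, 3.82⟩]
/-- LEVEL TWO, the WINNER's LEAK window `[t_on, t_on + 0.4)` (same carrier). -/
def leak : Fin 3 → Window :=
  ![⟨2.40, 2.80, ⟨1.10, -0.31, -2.05⟩, 0.36, -1.16⟩, ⟨2.45, 2.85, ⟨0.86, -0.25, -1.80⟩, 0.20, -1.26⟩, ⟨2.40, 2.80, ⟨0.10, 0.20, -3.54⟩, -0.03, -3.27⟩]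
/-- the level-two velocity-peak instants `t_U2` (lattice). -/
def tU2 : Fin 3 → ℝ := ![2.50, 2.55, 2.45]
/-- BACK over the post-peak half unit `[t_U2, t_U2 + ½]`. -/
def postPeakBack : Fin 3 → ℝ := ![-2.35, -2.49, -4.14]

/-- **THE WINNER IS SEQUENCED ON ONE CARRIER**: a strain-kept window (strain ≥ 2, |back| ≤ 0.2, total ≥ 2.85, length 0.35–0.40) is followed
on the same carrier by a leak window (back ≤ −1.8 with strain still ≥ 0.1 and total < −1), and the switch happens 0.05–0.10 BEFORE the
carrier's own velocity peak; the post-peak half unit has back ≤ −2.35 in every design. -/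
theorem winner_sequenced (d : Fin 3) :
    (2 ≤ (strainKept d).terms.strain ∧ |(strainKept d).terms.back| ≤ 0.2 ∧ 2.85 ≤ (strainKept d).total ∧
      0.35 ≤ (strainKept d).len ∧ (strainKept d).len ≤ 0.41) ∧
    ((leak d).a = (strainKept d).b ∧ (leak d).terms.back ≤ -1.8 ∧ 0.1 ≤ (leak d).terms.strain ∧ (leak d).total < -1) ∧
    (0.05 ≤ tU2 d - (strainKept d).b ∧ tU2 d - (strainKept d).b ≤ 0.1) ∧ postPeakBack d ≤ -2.35 := by
  fin_cases d <;> simp [strainKept, leak, tU2, postPeakBack, Window.len] <;> norm_num [abs_of_neg]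

/-- What the strain-kept window buys by §1's currency: its rate–length product `total · len` is ≥ 1.0 in every design (growth factor ≥
exp ½ ≈ 1.65; recorded W 21.2 → 34.9 = ×1.65 on A), while the leak window's product is ≤ −0.46. -/
theorem strainKept_product (d : Fin 3) : 1.0 ≤ (strainKept d).total * (strainKept d).len ∧ (leak d).total * (leak d).len ≤ -0.46 := by
  fin_cases d <;> simp [strainKept, leak, Window.len] <;> norm_num

/-- The INCUMBENT's last row before the hop (t 2.00) and the WINNER's first row (t 2.05): (strain, back) pairs, the hop length, and the
winner's distance from the level-one ω-argmax at ignition. -/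
structure Hop where
  /-- incumbent strain at its last row -/
  incStrain : ℝ
  /-- incumbent back at its last row -/
  incBack : ℝ
  /-- winner strain at its first row -/
  winStrain : ℝ
  /-- winner back at its first row -/
  winBack : ℝ
  /-- hop length (argmax displacement) -/
  jump : ℝ
  /-- distance winner ↔ level-one ω-argmax at the winner's first row -/
  dLevelOne : ℝ

/-- the three takeover hops of record (A / B / C). -/
def hop : Fin 3 → Hop := ![⟨0.33, -3.43, 2.14, -0.09, 0.87, 0.29⟩, ⟨0.44, -3.19, 2.00, 0.10, 0.74, 0.21⟩, ⟨0.94, -2.63, 2.02, -0.55, 0.71, 0.26⟩]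

/-- half a level-two band wavelength, `ℓ₂/2 = π/9`. -/
def halfEll2 : ℝ := Real.pi / 9

/-- `ℓ₂/2 = π/9` lies in (0.34, 0.36). -/
theorem halfEll2_bounds : 0.34 < halfEll2 ∧ halfEll2 < 0.36 := by
  unfold halfEll2
  constructor
  · rw [lt_div_iff₀ (by norm_num : (0:ℝ) < 9)]; linarith [Real.pi_gt_d2]
  · rw [div_lt_iff₀ (by norm_num : (0:ℝ) < 9)]; linarith [Real.pi_lt_d2]

/-- **THE INCUMBENT DIES BY LEAK; THE HOP TRADES A DRAINED CARRIER FOR A STRAIN-FED ONE NEXT TO LEVEL ONE**: at its last row the incumbent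
has back ≤ −2.6 with strain still > 0; the winner's first row has strain ≥ 2 and back ≥ −0.55; the hop is ≥ 0.71 (> ℓ₂/2) while the landing
site is within 0.29 (< ℓ₂/2) of the level-one ω-argmax. -/
theorem incumbent_dies_by_leak (d : Fin 3) :
    (hop d).incBack ≤ -2.6 ∧ 0 < (hop d).incStrain ∧ 2 ≤ (hop d).winStrain ∧ -0.55 ≤ (hop d).winBack ∧
    0.71 ≤ (hop d).jump ∧ (hop d).dLevelOne ≤ 0.29 := by
  fin_cases d <;> simp [hop] <;> norm_num

/-- … hence, with `halfEll2_bounds`: every hop exceeds half a band wavelength and every landing is inside half a band wavelength of the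
level-one argmax (the takeover criterion of record and the 'born next to the parent' reading, as inequalities). -/
theorem hop_vs_halfEll2 (d : Fin 3) : halfEll2 < (hop d).jump ∧ (hop d).dLevelOne < halfEll2 := by
  obtain ⟨h1, h2⟩ := halfEll2_bounds
  obtain ⟨-, -, -, -, hj, hd⟩ := incumbent_dies_by_leak d
  constructor <;> linarith

/-- LEVEL-ONE carriers by phase relative to their own velocity peak `t_U1`: windows `[t_U1−1, t_U1−½]`, `[t_U1−½, t_U1]`, `[t_U1, t_U1+½]`,
`[t_U1+½, t_U1+1]` (the last one clipped at the leg's end for D). Relay designs A / B / C, then the break point D. -/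
def levelOnePhases : Fin 3 → Fin 4 → Terms :=
  ![![⟨1.105, 0.119, -0.547⟩, ⟨0.720, -0.098, -0.529⟩, ⟨0.510, -0.358, -0.418⟩, ⟨0.580, -0.341, -1.244⟩],
    ![⟨1.115, 0.123, -0.531⟩, ⟨0.799, -0.071, -0.590⟩, ⟨0.573, -0.355, -0.422⟩, ⟨0.604, -0.342, -1.198⟩],
    ![⟨1.032, 0.137, -0.546⟩, ⟨0.703, -0.061, -0.594⟩, ⟨0.564, -0.305, -0.540⟩, ⟨0.552, -0.317, -1.507⟩]]
/-- the break point's level-one carrier through the same four phases (t_U1 = 2.05). -/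
def breakPointPhases : Fin 4 → Terms := ![⟨1.591, -0.310, -0.028⟩, ⟨1.231, -0.278, 0.124⟩, ⟨0.008, -0.411, -0.267⟩, ⟨-0.955, -0.489, -1.285⟩]

/-- **RELAY LEVEL-ONE CARRIERS LEAK FROM BIRTH AND NEVER LOSE THEIR STRAIN SIGN; THE BREAK POINT LEAKS ONLY AFTER ITS STRAIN REVERSES.**
Relay designs: back ≤ −0.4 in ALL four phases (≤ −1.19 in the last) with strain ≥ 0.5 throughout. Break point: |back| ≤ 0.27 in the first
three phases with strain ≥ 1.2 before the peak, ≈ 0 at it (|strain| ≤ 0.01) and ≤ −0.9 after, where back ≤ −1.2 as well. -/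
theorem level_one_contrast :
    (∀ d p, (levelOnePhases d p).back ≤ -0.4 ∧ 0.5 ≤ (levelOnePhases d p).strain) ∧ (∀ d, (levelOnePhases d 3).back ≤ -1.19) ∧
    (∀ p : Fin 4, p ≠ 3 → |(breakPointPhases p).back| ≤ 0.27) ∧
    (1.2 ≤ (breakPointPhases 0).strain ∧ 1.2 ≤ (breakPointPhases 1).strain ∧ |(breakPointPhases 2).strain| ≤ 0.01 ∧
      (breakPointPhases 3).strain ≤ -0.9 ∧ (breakPointPhases 3).back ≤ -1.2) := by
  refine ⟨fun d p => ?_, fun d => ?_, fun p hp => ?_, ?_⟩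
  · fin_cases d <;> fin_cases p <;> simp [levelOnePhases] <;> norm_num
  · fin_cases d <;> simp [levelOnePhases] <;> norm_num
  · fin_cases p <;> simp [breakPointPhases] at hp ⊢ <;> norm_num [abs_of_neg, abs_of_pos]
  · simp [breakPointPhases]; norm_num [abs_of_pos]

/-- Instants per leg (A / B / C / D): level-one velocity peak `t_U1`, first row at which the level-one carrier's BACK reads ≤ −1, the
first level-two argmax hop after t 1, and the landing distance to the level-one ω-argmax. -/
structure Clock where
  /-- level-one U-peak (lattice) -/
  tU1 : ℝ
  /-- first row with level-one cap BACK ≤ −1 -/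
  tBack1 : ℝ
  /-- first level-two argmax hop after t 1 -/
  tHop2 : ℝ
  /-- distance of the new level-two argmax from the level-one ω-argmax at that row -/
  dLand : ℝ

/-- the four clocks of record. -/
def clock : Fin 4 → Clock := ![⟨1.40, 2.00, 2.05, 0.29⟩, ⟨1.35, 1.95, 2.05, 0.21⟩, ⟨1.40, 2.00, 2.05, 0.26⟩, ⟨2.05, 2.60, 2.75, 0.26⟩]

/-- **CROSS-LEVEL CLOCK AND PLACE (n = 4, break point included).** In every leg the first level-two hop comes 0.65–0.70 after the
level-one velocity peak and 0.05–0.15 after the level-one carrier's BACK first reads ≤ −1, landing within 0.21–0.29 of the level-one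
ω-argmax. -/
theorem cross_level_clock (i : Fin 4) :
    0.65 ≤ (clock i).tHop2 - (clock i).tU1 ∧ (clock i).tHop2 - (clock i).tU1 ≤ 0.7 ∧
    0.05 ≤ (clock i).tHop2 - (clock i).tBack1 ∧ (clock i).tHop2 - (clock i).tBack1 ≤ 0.15 ∧
    0.21 ≤ (clock i).dLand ∧ (clock i).dLand ≤ 0.29 := by
  fin_cases i <;> simp [clock] <;> norm_num

/-- The break point's level-one carrier: strain zero-crossing (linear interpolation between rows) and BACK switch-on row; the leak begins
within 0.02 AFTER the strain reversal, and both come ≥ 0.2 after its velocity peak. -/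
def bpStrainZero : ℝ := 2.28
/-- first row with the break point's level-one cap BACK ≤ −0.3 (−0.34 at 2.30; ≤ −0.5 sustained from 2.50). -/
def bpBackOn : ℝ := 2.30

/-- the ordering of record at the break point: peak (2.05) < strain zero (2.28) < back switch-on (2.30). -/
theorem breakpoint_leaks_after_reversal :
    (clock 3).tU1 + 0.2 < bpStrainZero ∧ bpStrainZero < bpBackOn ∧ bpBackOn ≤ bpStrainZero + 0.02 := by
  simp [clock, bpStrainZero, bpBackOn]; norm_num

/-! ## §3 The handle (h2) in life-cycle currency (arithmetic on the record; a price, not a prediction)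

START-HERE-R47-MEMO §2/§3 (HOME/pub-fluidc-atlas): the (b) door in pulse form needs the level-two pulse ratio 2.154 → ≥ 2.51, which
factors as (carrier change ×1.19) × (the winner's OWN growth ×1.81); at unchanged carrier change the winner's own growth must reach
2.51 / 1.19 ≈ 2.11, i.e. a further factor ≥ 1.166. By §1 a window contributes `exp (total · len / 2)`; two ways of record-arithmetic to find
the missing factor on design A: (i) EXTEND the strain-kept window at its recorded rate (+3.00) by Δ ≥ 0.111 — i.e. delay the BACK
switch-on from t_U2 − 0.10 to ≈ t_U2 + 0.01; (ii) HOLD BACK at its strain-kept value (−0.15) through the leak window [2.40, 2.80] with the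
other recorded terms unchanged (inj 0.36, strain 1.10, self −0.31, visc −0.27): total +0.73 instead of −1.16. -/

/-- the factor still missing in the winner's own growth: (2.51/1.19)/1.81. -/
def missingFactor : ℝ := 2.51 / 1.19 / 1.81

/-- it is below 1.166 (so any move supplying ×1.166 in the winner's own growth meets the pulse form of (b) at unchanged carrier change). -/
theorem missingFactor_lt : missingFactor < 1.166 ∧ 1.165 < missingFactor := by
  unfold missingFactor; constructor <;> norm_num

/-- **(i) DELAY THE SWITCH-ON.** At the strain-kept rate 3.00, an extra length 0.111 gives a growth factor ≥ 1.166 (crude bound `1 + x ≤ eˣ`). -/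
theorem delay_price : (1.166 : ℝ) ≤ growthFactor 3.00 0.111 := by
  have := one_add_le_growthFactor 3.00 0.111
  norm_num at this ⊢; linarith

/-- **(ii) HOLD THE LEAK.** With back held at −0.15 instead of −2.05 over the 0.40-long leak window of design A, the window total is
0.36 + 1.10 − 0.31 − 0.15 − 0.27 = +0.73 (recorded: −1.16); a rate +0.73 over 0.40 gives a factor ≥ 1.146 while the recorded −1.16 over the
same window gives a factor ≤ 0.812 — so holding the leak buys, against the record, a factor ≥ 1.146 / 0.812 > 1.166 by the end of that window. -/
theorem hold_price :
    (0.36 + 1.10 - 0.31 - 0.15 - 0.27 : ℝ) = 0.73 ∧ (1.146 : ℝ) ≤ growthFactor 0.73 0.40 ∧ growthFactor (-1.16) 0.40 ≤ 0.812 ∧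
    (1.166 : ℝ) * 0.812 < 1.146 := by
  refine ⟨by norm_num, ?_, ?_, by norm_num⟩
  · have := one_add_le_growthFactor 0.73 0.40; norm_num at this ⊢; linarith
  · -- exp (−0.232) = 1 / exp 0.232 ≤ 1 / 1.232 ≤ 0.812
    have h := Real.add_one_le_exp (0.232 : ℝ)
    have hpos : (0 : ℝ) < 1.232 := by norm_num
    unfold growthFactor
    rw [show (-1.16 : ℝ) * 0.40 / 2 = -0.232 by norm_num, Real.exp_neg]
    calc (Real.exp 0.232)⁻¹ ≤ (1.232 : ℝ)⁻¹ := inv_anti₀ hpos (by norm_num at h ⊢; linarith)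
      _ ≤ 0.812 := by norm_num

/-! ## §4 The floor-beating class: three PRE-STATED tests on the level-one sup carrier (`p123.py`, STATUS p1 gen 17 KIT + PRE-STATEMENT line)

P1 NO-LEAK-TO-PEAK: the cap BACK rate at the [5,9) sup carrier stays ≥ −0.3 in every row of [0.4, t_U1] and STRAIN ≥ +1.0 over [t_U1 − 1, t_U1 − ½];
P2 LEAK-AFTER-REVERSAL: the BACK switch-on (≤ −0.5 for three rows) comes after t_U1 and not before the strain zero-crossing − 0.1;
P3 RING: at the slice instant nearest t_U1, at least two of the three orthogonal |ω_[5,9)| planes through the argmax read 'annulus' (best-centre hole ≤ 0.3,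
rim at ≥ 2 px) and angle(u, ω) at the argmax ≥ 75°. Designs: the break point D = u0⁽²⁾ and the three further one-shot floor-beating designs E = u0⁽¹⁾,
F = R3 row (b), G = row (e) (128³ legs j255377 / j260498 / j260499 / j260504) against the relay designs A / B / C (j255374–6). Numbers only. -/

/-- The inputs of the three tests for one design's level-one carrier. -/
structure PInputs where
  /-- r₁ of the leg (lattice) -/
  r1 : ℝ
  /-- min over [0.4, t_U1] of the cap BACK rate -/
  minBack : ℝ
  /-- mean STRAIN over [t_U1 − 1, t_U1 − ½] -/
  strainPre : ℝ
  /-- level-one velocity-peak instant -/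
  tU1 : ℝ
  /-- BACK switch-on instant (≤ −0.5 × 3 rows); a value past the leg's end encodes 'none' -/
  tOn : ℝ
  /-- strain zero-crossing instant -/
  tZero : ℝ
  /-- number of planes (of 3) reading 'annulus' at the slice nearest t_U1 -/
  nAnnulus : ℕ
  /-- angle between u_out and ω_out at the argmax there (degrees) -/
  angleUW : ℝ

/-- P1 NO-LEAK-TO-PEAK. -/
def P1 (x : PInputs) : Prop := -0.3 ≤ x.minBack ∧ 1.0 ≤ x.strainPre
/-- P2 LEAK-AFTER-REVERSAL. -/
def P2 (x : PInputs) : Prop := x.tU1 < x.tOn ∧ x.tZero - 0.1 ≤ x.tOn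
/-- P3 RING. -/
def P3 (x : PInputs) : Prop := 2 ≤ x.nAnnulus ∧ 75 ≤ x.angleUW

/-- the break point D = u0⁽²⁾ (leg u02x-N128). -/
def pD : PInputs := ⟨1.919, -0.23, 1.60, 2.05, 2.50, 2.28, 2, 88⟩
/-- the relay designs A / B / C at their level one. -/
def pRelay : Fin 3 → PInputs := ![⟨0.824, -0.98, 1.09, 1.40, 0.65, 3.13, 1, 62⟩, ⟨0.816, -0.98, 1.12, 1.35, 0.60, 3.14, 1, 45⟩, ⟨0.869, -0.96, 1.01, 1.40, 0.55, 3.05, 1, 45⟩]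
/-- the three further one-shot floor-beating designs E = u0⁽¹⁾ (r₁ 1.906), F = R3 row (b) (1.393, ν₀), G = row (e) (1.099, ν₀) — legs j260498 / j260499 / j260504.
(G's `tOn` is its FIRST switch-on 0.45, an early carrier replaced at 0.8; `minBack` over [0.4, t_U1] includes that phase.) -/
def pE : PInputs := ⟨1.906, -0.21, 1.64, 2.05, 2.45, 2.22, 2, 84⟩
/-- F = R3 row (b). -/
def pF : PInputs := ⟨1.393, -0.32, 0.85, 2.05, 2.35, 2.56, 2, 79⟩
/-- G = R3 row (e). -/
def pG : PInputs := ⟨1.099, -1.19, 0.92, 2.00, 0.45, 2.52, 0, 85⟩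

/-- **THE BREAK POINT PASSES P1, P2, P3.** -/
theorem breakpoint_passes : P1 pD ∧ P2 pD ∧ P3 pD := by
  simp [P1, P2, P3, pD]; norm_num

/-- **EVERY RELAY DESIGN FAILS P1, P2 AND P3** (BACK −0.96…−0.98 before the peak; switch-on at 0.55–0.65 ≪ t_U1; one annulus plane, angle ≤ 62°) — although each
has pre-peak strain ≥ 1.0 (the strain half of P1 holds for them too: the difference is the leak, not the gain). -/
theorem relay_designs_fail (d : Fin 3) : ¬ P1 (pRelay d) ∧ ¬ P2 (pRelay d) ∧ ¬ P3 (pRelay d) ∧ 1.0 ≤ (pRelay d).strainPre := by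
  fin_cases d <;> simp [P1, P2, P3, pRelay] <;> norm_num

/-- **E PASSES P1, P2, P3** — a second clean break-point-class carrier (min BACK −0.21, strain +1.64; switch-on 2.45 after strain zero 2.22; two annulus
planes, 84°). -/
theorem E_passes : P1 pE ∧ P2 pE ∧ P3 pE := by
  simp [P1, P2, P3, pE]; norm_num

/-- **F: P1 NO (at the margins: −0.32 vs −0.3 and +0.85 vs 1.0), P2 NO (leak switches on 0.21 BEFORE the strain zero), P3 YES (ring).** -/
theorem F_outcome : ¬ P1 pF ∧ ¬ P2 pF ∧ P3 pF ∧ (-0.32 ≤ pF.minBack ∧ pF.tU1 < pF.tOn ∧ pF.tOn + 0.21 ≤ pF.tZero) := by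
  simp [P1, P2, P3, pF]; norm_num

/-- **G: NO / NO / NO** (an early leaking carrier; partial annulus only). -/
theorem G_outcome : ¬ P1 pG ∧ ¬ P2 pG ∧ ¬ P3 pG := by
  simp [P1, P2, P3, pG]; norm_num

/-- THE GRADED COLUMN (post hoc; numbers only): per design, r₁ and the lag of the post-peak leak switch-on behind the carrier's own strain
zero-crossing, `lag = tOn(post-peak) − tZero` (positive = leak only after reversal). Designs D, E, F, G, C, A, B. -/
def r1Lag : Fin 7 → ℝ × ℝ := ![(1.919, 0.22), (1.906, 0.23), (1.393, -0.21), (1.099, -0.27), (0.869, -1.35), (0.824, -1.38), (0.816, -1.39)]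

/-- **THE LAG ORDERS THE DESIGNS AS r₁ DOES**: for every pair `i < j` in the list (which is sorted by non-increasing r₁ up to the D/E tie of 0.013),
the lag is non-increasing too, with the single inversion at the D/E tie (lags 0.22 vs 0.23) — i.e. the map r₁ ↦ lag is monotone on this record at
resolution 0.02. Stated as: consecutive r₁ are non-increasing, consecutive lags are non-increasing from index 1 on, and |lag 0 − lag 1| ≤ 0.01. -/
theorem lag_monotone_with_r1 :
    (∀ i : Fin 6, (r1Lag i.succ).1 ≤ (r1Lag i.castSucc).1) ∧
    (∀ i : Fin 6, i ≠ 0 → (r1Lag i.succ).2 ≤ (r1Lag i.castSucc).2) ∧ |(r1Lag 0).2 - (r1Lag 1).2| ≤ 0.01 ∧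
    (∀ i : Fin 7, 1.3 ≤ (r1Lag i).1 ↔ -0.25 ≤ (r1Lag i).2) ∧ (∀ i : Fin 7, 1 ≤ (r1Lag i).1 ↔ -0.3 ≤ (r1Lag i).2) := by
  refine ⟨fun i => ?_, fun i hi => ?_, ?_, fun i => ?_, fun i => ?_⟩
  · fin_cases i <;> simp [r1Lag] <;> norm_num
  · fin_cases i <;> simp [r1Lag] at hi ⊢ <;> norm_num
  · simp [r1Lag]; norm_num [abs_le]
  · fin_cases i <;> simp [r1Lag] <;> norm_num
  · fin_cases i <;> simp [r1Lag] <;> norm_num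


end Summit.NavierStokesRegularity.FluidComputer.CarrierLifeCycle

end
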